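import Literature.AnabelianGeometry.EtaleTheta.SettingModelMuTwoInversion
import Literature.AnabelianGeometry.EtaleTheta.MuTwoSettingCLevel
import HarnessLib

/-!
# C-level data for the inversion model of [EtTh] Def. 1.7, and `ε_±`-conjugation in the `conjX` vocabulary

S. Mochizuki, *The étale theta function and its Frobenioid-theoretic manifestations*, Publ. RIMS **45** (2009) [EtTh],
Def. 1.7 p. 27 (PRIMS p. 253) («`X^log → C^log` … the stack-theoretic quotient … by the natural action of `±1`»), §2
p. 36 (PRIMS p. 262) («`1 → Δ_C → Π_C → G_K → 1`», «`ι` … “multiplication by `−1`”»), Prop. 2.2 (i) p. 37.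
[cite: MochizukiEtTh2009, Def 1.7 p.27]

Cell abc-iut, seat abc-iut-w5-d072 (gen 3; (R1) ι-datum custody, GAP G-w4d010-2 / D-G-w4d010-2h). abc-iut-L2-d3's
PARAMETER record `MuTwoSetting.CLevelData M` (`MuTwoSettingCLevel.lean`: `inclX` an open embedding + an augmentation
`augC : Π^tp_C → G_{ℚ_p}` of image `G_K` extending `aug`) is what turns conjugation by an element `g ∈ Π^tp_C` into a
TOPOLOGICAL automorphism `e.conjX g` of `Π^tp_X` — the vocabulary in which abc-iut-L2-d3 / abc-iut-L2-t10 (`PiCData`,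
`CoverDataAx`, G-L2t10-2, G-L2t10-4) and abc-iut-L6-t19 (`PlusMinusTowerCoverModel*`) consume the inversion `ε_±`. This file:

* §1 **`MuTwoSetting.inversionModel_cLevelData p : (MuTwoSetting.inversionModel p).CLevelData`** — the semidirect model
  `Π^tp_C = Π^tp_X ⋊_ι ℤ/2` (`SettingModelMuTwoInversion.lean`) CARRIES C-level data: `inclX = inl` is an open embedding
  (discrete), and `augC := SemidirectProduct.lift aug 1` (well defined because `ι` is over `G_{ℚ_p}`: `aug ∘ φ_z = aug`)
  extends `aug` with image `G_K = G_{ℚ_p}`; so `NV-L2/CLevelData` has a producer whose `ε_±` is a GENUINE inversion;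
* §2 for EVERY `e : (inversionModel p).CLevelData`: **`e.conjX ε_± = SettingModel.inversion p`** (`conjX_epsPM_inversionModel`),
  hence (R1b′) `map_deltaTemp_conjX_epsPM_inversionModel`, (R1c) `toZ_conjX_epsPM_inversionModel`, (R1e′)
  `hinv_conjX_epsPM_inversionModel` («`ι̂ ≡ −1` on `Δ_X^ab`» for `ι := e.conjX ε_±`), and `conjX_epsPM_inversionModel_ne_refl`;
* §3 for EVERY `e : (MuTwoSetting.model p).CLevelData` (abc-iut-L2-t1's product model; producer = abc-iut-w5-d221's row):
  `e.conjX ε_± = refl` (`conjX_epsPM_model`), so (R1c)/(R1e′) FAIL there (`not_hZ_conjX_epsPM_model`,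
  `not_hinv_conjX_epsPM_model`) — abc-iut-w4-d014's P1 in the `conjX` vocabulary;
* §4 headline `MuTwoSetting.exists_cLevelData_conjX_epsPM_inversion`: ∃ `M` with C-level data `e`, the origin guard and an
  admissible `ε_Z`, such that `e.conjX M.epsPM` is a nontrivial involution over `G_K` with (R1b′) ∧ (R1c) ∧ (R1e′).

HONEST LIMITS as in `SettingModelMuTwoInversion.lean`: semi-synthetic, everything discrete, root `Π^tp_X = F₂ × G_{ℚ_p}` a direct
product (Kummer-level data vacuous over it, abc-iut-L2-lead R77); NOT the tempered fundamental group of an orbicurve; class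
(b) construction under the DEFS-FREEZE (two new defs: the augmentation `augCInv` and the C-level data record). Nothing of [EtTh] is asserted; no side is taken
on [IUTchIII] Cor. 3.12; typed ≠ proved; instantiated ≠ endorsed.
-/

noncomputable section

namespace Literature.AnabelianGeometry.EtaleTheta.SettingModel

open Literature.AnabelianGeometry.SemiGraphs
open _root_.Topology

variable (p : ℕ) [Fact p.Prime]

/-! ## §1. The augmentation `Π^tp_C = Π^tp_X ⋊_ι ℤ/2 → G_{ℚ_p}` and the C-level data record -/

/-- `aug ∘ φ(z) = aug` for the `ℤ/2`-action through `ι` (`ι` is over `G_{ℚ_p}`), in the form required by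
`SemidirectProduct.lift` with trivial second component. [cite: MochizukiEtTh2009, Def 1.7 p.27] -/
theorem augM_comp_inversionAction (z : Multiplicative (ZMod 2)) :
    (augM p).toMonoidHom.comp (inversionAction p z).toMonoidHom =
      (MulAut.conj ((1 : Multiplicative (ZMod 2) →* GQp p) z)).toMonoidHom.comp (augM p).toMonoidHom := by
  have key : ∀ z : Multiplicative (ZMod 2), z = 1 ∨ z = Multiplicative.ofAdd 1 := by decide
  refine MonoidHom.ext fun x => ?_
  simp only [MonoidHom.comp_apply, MulEquiv.coe_toMonoidHom, MonoidHom.one_apply, map_one, MulAut.one_apply]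
  rcases key z with rfl | rfl
  · rw [map_one, MulAut.one_apply]
  · rw [inversionAction_ofAdd_one]
    exact aug_inversion p x

/-- **The augmentation `Π^tp_C → G_{ℚ_p}` of the inversion model**: `(x, z) ↦ aug x` (a homomorphism because `ι` is
over `G_{ℚ_p}`), continuous (discrete source). [cite: MochizukiEtTh2009, §2 p.36] -/
def augCInv : PiCInv p →ₜ* GQp p where
  toMonoidHom := SemidirectProduct.lift (augM p).toMonoidHom 1 (augM_comp_inversionAction p)
  continuous_toFun := continuous_of_discreteTopology

/-- `augC ∘ inclX = aug`. [cite: MochizukiEtTh2009, §2 p.36] -/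
theorem augCInv_inclInv (x : PiTp p) : augCInv p (inclInv p x) = augM p x :=
  SemidirectProduct.lift_inl (augM p).toMonoidHom 1 (augM_comp_inversionAction p) x

/-- `augC (x, z) = aug x`. [cite: MochizukiEtTh2009, §2 p.36] -/
theorem augCInv_apply (g : PiCInv p) : augCInv p g = augM p (SemidirectProduct.left g) := by
  change (augM p).toMonoidHom (SemidirectProduct.left g) * (1 : Multiplicative (ZMod 2) →* GQp p)
    (SemidirectProduct.right g) = _
  rw [MonoidHom.one_apply, mul_one]
  rfl

/-- **C-LEVEL DATA FOR THE INVERSION MODEL** (abc-iut-L2-d3's `MuTwoSetting.CLevelData`): `inclX = inl` is an open embedding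
and `augC` extends `aug` with image `G_K (= G_{ℚ_p})`. A producer of `NV-L2/CLevelData` whose `ε_±` is a genuine inversion.
[cite: MochizukiEtTh2009, Def 1.7 p.27] -/
def _root_.Literature.AnabelianGeometry.EtaleTheta.MuTwoSetting.inversionModel_cLevelData :
    (MuTwoSetting.inversionModel p).CLevelData where
  isOpenEmbedding_inclX :=
    IsOpenEmbedding.of_continuous_injective_isOpenMap continuous_of_discreteTopology
      SemidirectProduct.inl_injective (fun _ _ => isOpen_discrete _)
  augC := augCInv p
  augC_inclX x := augCInv_inclInv p x
  range_augC := by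
    change (augCInv p).toMonoidHom.range = (⊥ : IntermediateField ℚ_[p] (PadicAlgCl p)).fixingSubgroup
    rw [IntermediateField.fixingSubgroup_bot]
    exact MonoidHom.range_eq_top.mpr fun σ => ⟨inclInv p ((1 : Del), (σ : Gam p)), by
      change augCInv p (inclInv p ((1 : Del), (σ : Gam p))) = σ
      rw [augCInv_inclInv]
      rfl⟩

/-- Hence `CLevelData` is inhabited at the inversion model. [cite: MochizukiEtTh2009, Def 1.7 p.27] -/
theorem _root_.Literature.AnabelianGeometry.EtaleTheta.MuTwoSetting.nonempty_cLevelData_inversionModel :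
    Nonempty (MuTwoSetting.inversionModel p).CLevelData :=
  ⟨MuTwoSetting.inversionModel_cLevelData p⟩

/-! ## §2. `e.conjX ε_±` at the inversion model is the pointed inversion -/

/-- **For every C-level datum `e` of the inversion model, `e.conjX ε_± = SettingModel.inversion p`** (conjugation by
`ε_± = (1, 1̄)` on `Π^tp_X ⊴ Π^tp_X ⋊_ι ℤ/2` is `ι`; `conjX` depends on `e` only through continuity).
[cite: MochizukiEtTh2009, §2 p.36] -/
theorem conjX_epsPM_inversionModel (e : (MuTwoSetting.inversionModel p).CLevelData) :
    e.conjX (MuTwoSetting.inversionModel p).epsPM = inversion p := by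
  refine ContinuousMulEquiv.ext fun x => (MuTwoSetting.inversionModel p).injective_inclX ?_
  rw [e.inclX_conjX]
  exact MuTwoSetting.inversionModel_epsPM_conj p x

/-- (R1b′) for `ι := e.conjX ε_±` at the inversion model: `ι(Δ^tp_X) = Δ^tp_X`. [cite: Mochizuki2012, Rmk 1.4.1 (ii) p.28] -/
theorem map_deltaTemp_conjX_epsPM_inversionModel (e : (MuTwoSetting.inversionModel p).CLevelData) :
    (MuTwoSetting.inversionModel p).DeltaTemp.map
        (e.conjX (MuTwoSetting.inversionModel p).epsPM).toMulEquiv.toMonoidHom =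
      (MuTwoSetting.inversionModel p).DeltaTemp := by
  rw [conjX_epsPM_inversionModel]
  exact map_deltaTemp_inversion p

/-- (R1c) for `ι := e.conjX ε_±` at the inversion model: `toZ (ι g) = (toZ g)⁻¹`. [cite: Mochizuki2012, Prop 2.2 (ii) p.66] -/
theorem toZ_conjX_epsPM_inversionModel (e : (MuTwoSetting.inversionModel p).CLevelData) (g : PiTp p) :
    (MuTwoSetting.inversionModel p).toZ (e.conjX (MuTwoSetting.inversionModel p).epsPM g) =
      ((MuTwoSetting.inversionModel p).toZ g)⁻¹ := by
  rw [conjX_epsPM_inversionModel]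
  exact toZ_inversion p g

/-- **(R1e′) for `ι := e.conjX ε_±` at the inversion model**: «`ι̂ ≡ −1` on `Δ_X^ab`». [cite: MochizukiEtTh2009, Prop 2.2 (i) p.37] -/
theorem hinv_conjX_epsPM_inversionModel (e : (MuTwoSetting.inversionModel p).CLevelData) :
    ∀ g ∈ (MuTwoSetting.inversionModel p).DeltaHat,
      (MuTwoSetting.inversionModel p).completionAut (e.conjX (MuTwoSetting.inversionModel p).epsPM) g * g ∈
        (⁅(MuTwoSetting.inversionModel p).DeltaHat, (MuTwoSetting.inversionModel p).DeltaHat⁆).topologicalClosure := by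
  rw [conjX_epsPM_inversionModel]
  exact inversion_hinv p

/-- `e.conjX ε_±` at the inversion model is NOT the identity (an outer automorphism of `Π^tp_X`).
[cite: MochizukiEtTh2009, Def 1.7 p.27] -/
theorem conjX_epsPM_inversionModel_ne_refl (e : (MuTwoSetting.inversionModel p).CLevelData) :
    e.conjX (MuTwoSetting.inversionModel p).epsPM ≠ ContinuousMulEquiv.refl _ := by
  rw [conjX_epsPM_inversionModel]
  exact inversion_ne_refl p

/-! ## §3. `e.conjX ε_±` at abc-iut-L2-t1's product model is the identity -/

/-- **For every C-level datum `e` of the product model `MuTwoSetting.model p`, `e.conjX ε_± = 1`** (`ε_± = (1, 1̄)` is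
central in `Π^tp_X × ℤ/2`). [cite: MochizukiEtTh2009, Def 1.7 p.27] -/
theorem conjX_epsPM_model (e : (MuTwoSetting.model p).CLevelData) :
    e.conjX (MuTwoSetting.model p).epsPM = ContinuousMulEquiv.refl _ := by
  refine ContinuousMulEquiv.ext fun x => (MuTwoSetting.model p).injective_inclX ?_
  rw [e.inclX_conjX]
  change ((1, Multiplicative.ofAdd 1) : PiC p) * (x, 1) * ((1, Multiplicative.ofAdd 1) : PiC p)⁻¹ = (x, 1)
  ext <;> simp

/-- (R1e′) FAILS for `ι := e.conjX ε_±` at the product model. [cite: MochizukiEtTh2009, Prop 2.2 (i) p.37] -/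
theorem not_hinv_conjX_epsPM_model (e : (MuTwoSetting.model p).CLevelData) :
    ¬ ∀ g ∈ (MuTwoSetting.model p).DeltaHat,
      (MuTwoSetting.model p).completionAut (e.conjX (MuTwoSetting.model p).epsPM) g * g ∈
        (⁅(MuTwoSetting.model p).DeltaHat, (MuTwoSetting.model p).DeltaHat⁆).topologicalClosure := by
  rw [conjX_epsPM_model]
  exact not_hinv_refl p

/-- (R1c) FAILS for `ι := e.conjX ε_±` at the product model (`toZ (ι a) = toZ a = 1 ≠ −1`).
[cite: Mochizuki2012, Prop 2.2 (ii) p.66] -/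
theorem not_hZ_conjX_epsPM_model (e : (MuTwoSetting.model p).CLevelData) :
    ¬ ∀ g ∈ (MuTwoSetting.model p).DeltaTemp,
      (MuTwoSetting.model p).toZ (e.conjX (MuTwoSetting.model p).epsPM g) = ((MuTwoSetting.model p).toZ g)⁻¹ := by
  intro h
  have h1 := h (genA p) (genA_mem_deltaTemp p)
  rw [conjX_epsPM_model, ContinuousMulEquiv.coe_refl, id] at h1
  change (ThetaSetting.model p).toZ (genA p) = ((ThetaSetting.model p).toZ (genA p))⁻¹ at h1
  rw [toZ_genA, ← ofAdd_neg] at h1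
  have h2 : (1 : ℤ) = -1 := Multiplicative.ofAdd.injective h1
  omega

/-! ## §4. Joint satisfiability in the `conjX` vocabulary -/

/-- **[EtTh] Def. 1.7 with C-level data admits a model whose `ε_±` conjugates `Π^tp_X` by a genuine inversion**: there are
`M : MuTwoSetting p` and `e : M.CLevelData` with the origin guard and an admissible `ε_Z` such that `ι := e.conjX M.epsPM` is a
nontrivial involution over `G_K` satisfying (R1b′) `ι(Δ^tp_X) = Δ^tp_X`, (R1c) `toZ ∘ ι = toZ⁻¹` and (R1e′) «`ι̂ ≡ −1` on
`Δ_X^ab`» — witness the inversion model with its C-level data; by §3 these facets are NOT consequences of the interface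
(they fail at the product model for every `e`). [cite: MochizukiEtTh2009, Prop 2.2 (i) p.37] -/
theorem _root_.Literature.AnabelianGeometry.EtaleTheta.MuTwoSetting.exists_cLevelData_conjX_epsPM_inversion :
    ∃ (M : MuTwoSetting p) (e : M.CLevelData), M.toThetaSetting.IsEtThOrigin ∧ (∃ εZ : M.GtpC, M.IsAdmissibleEpsZ εZ) ∧
      e.conjX M.epsPM ≠ ContinuousMulEquiv.refl M.PiTemp ∧ (∀ g, e.conjX M.epsPM (e.conjX M.epsPM g) = g) ∧
      (∀ g, M.aug (e.conjX M.epsPM g) = M.aug g) ∧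
      M.DeltaTemp.map (e.conjX M.epsPM).toMulEquiv.toMonoidHom = M.DeltaTemp ∧
      (∀ g, M.toZ (e.conjX M.epsPM g) = (M.toZ g)⁻¹) ∧
      ∀ g ∈ M.DeltaHat, M.completionAut (e.conjX M.epsPM) g * g ∈ (⁅M.DeltaHat, M.DeltaHat⁆).topologicalClosure := by
  refine ⟨MuTwoSetting.inversionModel p, MuTwoSetting.inversionModel_cLevelData p,
    MuTwoSetting.inversionModel_isEtThOrigin p, ⟨_, MuTwoSetting.inversionModel_isAdmissibleEpsZ p⟩,
    conjX_epsPM_inversionModel_ne_refl p _, ?_, ?_, map_deltaTemp_conjX_epsPM_inversionModel p _,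
    toZ_conjX_epsPM_inversionModel p _, hinv_conjX_epsPM_inversionModel p _⟩
  · intro g
    rw [conjX_epsPM_inversionModel]
    exact inversion_inversion p g
  · intro g
    rw [conjX_epsPM_inversionModel]
    exact aug_inversion p g

end Literature.AnabelianGeometry.EtaleTheta.SettingModel

end
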